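import Literature.NumberTheory.GaloisRepresentations.IdeleClassFundamentalClassArtin
import Literature.NumberTheory.GaloisRepresentations.IdeleClassInvariantNaturality
import HarnessLib

/-!
# The pairing `inv_{E/F}(Inf(ι[x] ∪ δχ_σ))` with the characters of a CYCLIC sub-layer `K/F` of an arbitrary finite
# Galois layer `E/F`, through the canonical invariant `classInvAll` (Tate, C–F VII §11.2 (bis), §11.3)

Topic `NumberTheory/GaloisRepresentations`; namespace `Literature.NumberTheory.GaloisRepresentations.IdeleCohomology`
(sequel to door-c6 g13's `IdeleClassFundamentalClassArtin` — `carryInv_eq_neg_exponent_artin` at cyclic layers — and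
door-c5 g15's `IdeleClassInvariant` / `IdeleClassInvariantNaturality` — `classInvAll`, `classInvAll_eq_classInv`,
`classInvAll_classInf`, `fundamentalClassAll_eq_fundamentalClass`).  Theorems only (no definition, no named fact, no
instance, no notation, no `sorry`); number fields in `Type`.

A character `χ` of an arbitrary finite Galois group `Gal(E/F)` with values in `ℚ/ℤ` factors through a CYCLIC quotient
`Gal(K/F)`, `F ⊆ K ⊆ E`, and `ι_E[x] ∪ δχ` is the inflation of the carry class `[c_σ · ι_K[x]]` of the cyclic layer.  In the
tree's currency:

* **`classInvAll_classInf_carryClassHom`**: for `F ⊆ K ⊆ E` (`E/F` Galois, `K/F` cyclic with generator `σ`) and every idèle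
  `x` of `F`, `classInvAll F E (Inf_{K}^{E} [c_σ · ι_K[x]]) = −ι_σ(ψ_{K/F} x)/[K:F]` — the general-layer pairing is read on the
  cyclic layer (`inv ∘ Inf = inv`, door-c5) where door-c6 g13 computed it;
* **`classInvAll_carryClassHom`** (`E/F` cyclic): `classInvAll F E [c_σ · ι[x]] = −ι_σ(ψ_{E/F} x)/n`;
* **`normResidueSymbol_eq_artin_of_H2π_eq_fundamentalClassAll`** (`E/F` cyclic): every cocycle of class
  `fundamentalClassAll F E` has norm residue symbol `ψ_{E/F}` on `ι[x]`.

HONEST FRAMING: corollaries (classical, Tate 1967); no case of BSD / Poitou–Tate; written for Route A (A5) of crux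
`AnticycControlAdditiveK` (cell bsd-schneider) so that consumers holding door-c5's `classInvAll`/`fundamentalClassAll`
names get door-c6's §11.3 identities without unfolding.

## References
* J. W. S. Cassels, A. Fröhlich (eds.), *Algebraic Number Theory* (1967), Ch. VII (J. Tate) §11.2 (bis), §11.3.
  [CasselsFrohlichANT1967]
* J.-P. Serre, *Local Fields*, GTM 67 (1979), XI §2–§3. [SerreLocalFields1979]
-/

noncomputable section

open NumberField IsDedekindDomain CategoryTheory groupCohomology Function Field
open Literature.NumberTheory.Automorphic

namespace Literature.NumberTheory.GaloisRepresentations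

namespace IdeleCohomology

open Literature.Algebra.Homology IdeleClassGroup

/-! ## §1. Cyclic layers in the `classInvAll` / `fundamentalClassAll` currency -/

section Cyclic

variable {F : Type} [Field F] [NumberField F] {E : Type} [Field E] [NumberField E] [Algebra F E] [IsGalois F E]
variable [IsCyclic (E ≃ₐ[F] E)] (σ : E ≃ₐ[F] E) (hσ : ∀ g, g ∈ Subgroup.zpowers σ)

/-- **`classInvAll F E [c_σ · ι[x]] = −ι_σ(ψ_{E/F} x)/n`** for a cyclic layer (`classInvAll = classInv` there).
[cite: CasselsFrohlichANT1967, Ch. VII §11.3] -/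
theorem classInvAll_carryClassHom (x : ideleGroup F) :
    classInvAll F E (FiniteCyclic.carryClassHom σ hσ (galoisRep F E) (baseInvariant x)) =
      -(((((Unramified.exponent σ hσ
            (haveI := IsAbelianGalois.of_isCyclic F E; artinIdeleMapOfAlgebra F E artinReciprocity_character_holds x) : ℕ) : ℚ)) /
          (Nat.card (E ≃ₐ[F] E) : ℕ) : ℚ) : AddCircle (1 : ℚ)) := by
  rw [classInvAll_eq_classInv, ← carryInv_apply, carryInv_eq_neg_exponent_artin]

/-- **Every cocycle of class `fundamentalClassAll F E` of a CYCLIC layer has norm residue symbol `ψ_{E/F}`** on the classes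
`ι[x]` (door-c6 g13's `normResidueSymbol_baseInvariant_eq_artin` in door-c5's naming).
[cite: CasselsFrohlichANT1967, Ch. VII §11.3][cite: SerreLocalFields1979, Ch. XI §3] -/
theorem normResidueSymbol_eq_artin_of_H2π_eq_fundamentalClassAll {φ : cocycles₂ (galoisRep F E)}
    (hA : IsClassModule (galoisRep F E) φ) (hφ : H2π (galoisRep F E) φ = fundamentalClassAll F E) (x : ideleGroup F) :
    hA.normResidueSymbol (baseInvariant x) =
      Abelianization.of (haveI := IsAbelianGalois.of_isCyclic F E; artinIdeleMapOfAlgebra F E artinReciprocity_character_holds x) :=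
  normResidueSymbol_baseInvariant_eq_artin hA (hφ.trans (fundamentalClassAll_eq_fundamentalClass F E)) x

end Cyclic

/-! ## §2. A cyclic sub-layer `K/F` of an arbitrary finite Galois layer `E/F` -/

section SubLayer

variable (F K E : Type) [Field F] [NumberField F] [Field K] [NumberField K] [Algebra F K] [IsGalois F K]
  [Field E] [NumberField E] [Algebra F E] [IsGalois F E] [Algebra K E] [IsScalarTower F K E]
variable [IsCyclic (K ≃ₐ[F] K)] (σ : K ≃ₐ[F] K) (hσ : ∀ g, g ∈ Subgroup.zpowers σ)

/-- **`inv_{E/F}(Inf_{K}^{E} [c_σ · ι_K[x]]) = −ι_σ(ψ_{K/F} x)/[K:F]`**: the canonical invariant of the general layer `E/F`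
on the inflation of the carry class of a CYCLIC sub-layer `K/F` (`= ι_E[x] ∪ δ(χ_σ ∘ res)`) is the cyclic-layer value
(`classInvAll_classInf`, door-c5) computed by door-c6 g13 (`carryInv_eq_neg_exponent_artin`).
[cite: CasselsFrohlichANT1967, Ch. VII §11.2 (bis), §11.3][cite: SerreLocalFields1979, Ch. XI §2] -/
theorem classInvAll_classInf_carryClassHom (x : ideleGroup F) :
    classInvAll F E (classInf F K E 2 (FiniteCyclic.carryClassHom σ hσ (galoisRep F K) (baseInvariant x))) =
      -(((((Unramified.exponent σ hσ
            (haveI := IsAbelianGalois.of_isCyclic F K; artinIdeleMapOfAlgebra F K artinReciprocity_character_holds x) : ℕ) : ℚ)) /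
          (Nat.card (K ≃ₐ[F] K) : ℕ) : ℚ) : AddCircle (1 : ℚ)) := by
  rw [classInvAll_classInf, classInvAll_carryClassHom]

/-- **The kernel on the cyclic sub-layer**: `inv_{E/F}(Inf [c_σ · ι_K[x]]) = 0 ↔ x ∈ Fˣ N_{K/F} 𝕀_K` (`= ker ψ_{K/F}`).
[cite: CasselsFrohlichANT1967, Ch. VII §11.3, §5.1 Main Theorem (B)] -/
theorem classInvAll_classInf_carryClassHom_eq_zero_iff (x : ideleGroup F) :
    classInvAll F E (classInf F K E 2 (FiniteCyclic.carryClassHom σ hσ (galoisRep F K) (baseInvariant x))) = 0 ↔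
      x ∈ normGroup F K := by
  rw [classInvAll_classInf, classInvAll_eq_classInv, ← carryInv_apply, carryInv_eq_zero_iff]

end SubLayer

end IdeleCohomology

end Literature.NumberTheory.GaloisRepresentations

end
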